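import Summits.BirchSwinnertonDyer.BirchSwinnertonDyer.Theses.PAdicOrderV2

/-!
# Route PAdicOrderV2 — assembly item `Assembly`

`Assembly := PAdicOrderThesisR2 → BirchSwinnertonDyer` is literally the type of the route's
certified deciding theorem `closes`; this file closes the assembly item
stmt-BirchSwinnertonDyer-14749 by that theorem.
-/

namespace Summit.BirchSwinnertonDyer.BirchSwinnertonDyer.Theorems

open Summit.BirchSwinnertonDyer.BirchSwinnertonDyer.Theses.PAdicOrderV2

/-- The assembly item of route PAdicOrderV2: the thesis `PAdicOrderThesisR2` (∃ a good ordinary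
prime `p` and the newform `f` of a globally minimal `W` with `ord_T L_p(f, α_p, T)` equal to both
the analytic and the Mordell–Weil rank) implies `BirchSwinnertonDyer`. This is the type of the
route's deciding theorem `closes` (global minimal model
`WeierstrassCurve.hasGlobalMinimalModel_rat_holds`, Silverman AEC VIII.8.3; invariance of both
ranks under a variable change; `Nat.cast` injectivity in `ℕ∞`), so the proof is that theorem. -/
theorem assembly_proof :
    Summit.BirchSwinnertonDyer.BirchSwinnertonDyer.Theses.PAdicOrderV2.Assembly := by
  unfold Summit.BirchSwinnertonDyer.BirchSwinnertonDyer.Theses.PAdicOrderV2.Assembly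
  exact Summit.BirchSwinnertonDyer.BirchSwinnertonDyer.Theses.PAdicOrderV2.closes

end Summit.BirchSwinnertonDyer.BirchSwinnertonDyer.Theorems
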